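import Summits.Ventures.QEC.CircuitDistance.PortComposition
import Summits.Ventures.QEC.CircuitDistance.SchedWindow
import Summits.Ventures.QEC.CircuitDistance.SchedCoverBase
import Summits.Ventures.QEC.CircuitDistance.WitnessesQ4
import HarnessLib

/-!
# Q4 lane, ₛ-spine (10): the `sInf` bridge and the COMPOSITION `lower bound + witness ⇒ d_circ = w` for any CNOT order
# (`PortComposition.lean` re-pointed to `HasLogicalFaultOfWeightAtMostAtₛ σ S` / `circuitDistanceₛ σ S` under `hσ : σ.CycleFacts S`;
# venture QEC, experiment cell CDX, seat qec-cdx-type-2; proofs verbatim; nothing here asserts a value of `d_circ`)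

* `hasAtₛ_mono_weight`, `circuitDistanceₛ_eq_of_hasAt`, `hasAtₛ_iff_le_circuitDistance` (order-free `sInf` bookkeeping);
* **`circuitDistanceₛ_eq_of (hσ)`**: `¬ HasAtₛ σ S (w−1) (w−1)` + a weight-`≤ w` witness at `N₁` ⇒ `circuitDistanceₛ σ S Nc = w` for all
  `Nc ≥ N₁` (via `not_hasAtₛ_of_not_hasAtₛ_self` and `hasAtₛ_mono_cycles` of `SchedWindow`/`SchedNormalise`); `claimsₛ_of`,
  `claim_shapeₛ_of`;
* the #345 ASSEMBLY SHAPE **`sched345_circuitDistance_eq_eleven_of_sectors`**: the two sector exclusions at `N₀ = w = 10` (to be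
  discharged from the `o345` tables, the 246 X-sector leaves, the W = 10 tower and the transport lemma) give, with the landed weight-11
  witness (`WitnessesQ4`), `∀ Nc ≥ 1, circuitDistanceₛ sched345 bb144SM Nc = 11` — i.e. `¬ CDX_Q4_345` decided.
-/

namespace Summit.Ventures.QEC.CircuitDistance

open Literature.InformationTheory.QuantumCodes

variable {ℓ m : ℕ} [NeZero ℓ] [NeZero m]

/-! ## The `sInf` bridge -/

/-- Monotonicity in the weight (cf. `hasAt_mono_weight`). -/
theorem hasAtₛ_mono_weight (σ : SMSchedule) (S : SMCode ℓ m) (Nc : ℕ) {w w' : ℕ} (h : w ≤ w') :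
    HasLogicalFaultOfWeightAtMostAtₛ σ S Nc w → HasLogicalFaultOfWeightAtMostAtₛ σ S Nc w' := by
  rintro ⟨F, hU, hL, hw⟩; exact ⟨F, hU, hL, hw.trans h⟩

/-- **`circuitDistanceₛ` bridge** (cf. `circuitDistance_eq_of_hasAt`): an undetectable logical set of `≤ w` operations and none
of `≤ w − 1` give `circuitDistanceₛ σ S Nc = w`. -/
theorem circuitDistanceₛ_eq_of_hasAt (σ : SMSchedule) (S : SMCode ℓ m) (Nc w : ℕ) (hw : 1 ≤ w)
    (hlow : ¬ HasLogicalFaultOfWeightAtMostAtₛ σ S Nc (w - 1)) (hup : HasLogicalFaultOfWeightAtMostAtₛ σ S Nc w) :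
    circuitDistanceₛ σ S Nc = w := by
  unfold circuitDistanceₛ Gen.circuitDistance
  set A := {w | ∃ F : Finset (Fault ℓ m), Gen.Undetectable S Nc (allEventsₛ σ Nc) F ∧ Gen.LogicalError S (allEventsₛ σ Nc) F ∧
    faultCount F = w} with hA
  obtain ⟨F, hU, hL, hFw⟩ := hup
  have hmemF : faultCount F ∈ A := ⟨F, hU, hL, rfl⟩
  have hFeq : faultCount F = w := by
    by_contra hne
    exact hlow ⟨F, hU, hL, by omega⟩
  have hne : A.Nonempty := ⟨_, hmemF⟩
  have hmem := Nat.sInf_mem hne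
  obtain ⟨G, hGU, hGL, hG⟩ := hmem
  have hle : sInf A ≤ w := hFeq ▸ Nat.sInf_le hmemF
  have hge : w ≤ sInf A := by
    by_contra hlt
    exact hlow ⟨G, hGU, hGL, by omega⟩
  omega

/-- Conversely, once some undetectable logical set exists, `HasAtₛ … k ↔ circuitDistanceₛ ≤ k` (cf. `hasAt_iff_le_circuitDistance`). -/
theorem hasAtₛ_iff_le_circuitDistance (σ : SMSchedule) (S : SMCode ℓ m) (Nc w : ℕ)
    (hex : HasLogicalFaultOfWeightAtMostAtₛ σ S Nc w) (k : ℕ) :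
    HasLogicalFaultOfWeightAtMostAtₛ σ S Nc k ↔ circuitDistanceₛ σ S Nc ≤ k := by
  unfold circuitDistanceₛ Gen.circuitDistance
  set A := {w | ∃ F : Finset (Fault ℓ m), Gen.Undetectable S Nc (allEventsₛ σ Nc) F ∧ Gen.LogicalError S (allEventsₛ σ Nc) F ∧
    faultCount F = w} with hA
  obtain ⟨F, hU, hL, -⟩ := hex
  have hne : A.Nonempty := ⟨faultCount F, F, hU, hL, rfl⟩
  constructor
  · rintro ⟨G, hGU, hGL, hGk⟩
    have hG : faultCount G ∈ A := ⟨G, hGU, hGL, rfl⟩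
    exact (Nat.sInf_le hG).trans hGk
  · intro hk
    obtain ⟨G, hGU, hGL, hG⟩ := Nat.sInf_mem hne
    exact ⟨G, hGU, hGL, hG ▸ hk⟩

/-! ## Composition -/

/-- **COMPOSITION for any order with the cycle facts** (cf. `circuitDistance_eq_of`): lower bound at `N₀ = w − 1` cycles + witness
of weight `≤ w` at `N₁` cycles ⇒ `d_circ = w` for all `Nc ≥ N₁`. -/
theorem circuitDistanceₛ_eq_of {σ : SMSchedule} {S : SMCode ℓ m} (hσ : σ.CycleFacts S) (w N₁ : ℕ) (hw : 1 ≤ w)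
    (hlow : ¬ HasLogicalFaultOfWeightAtMostAtₛ σ S (w - 1) (w - 1))
    (hwit : HasLogicalFaultOfWeightAtMostAtₛ σ S N₁ w) (Nc : ℕ) (hNc : N₁ ≤ Nc) :
    circuitDistanceₛ σ S Nc = w :=
  circuitDistanceₛ_eq_of_hasAt σ S Nc w hw (not_hasAtₛ_of_not_hasAtₛ_self hσ (w - 1) hlow Nc) (hasAtₛ_mono_cycles hσ hNc w hwit)

/-- The `∃ Nc` forms (cf. `claims_of`): `¬ HasLogicalFaultOfWeightAtMostₛ σ S (w−1) ∧ HasLogicalFaultOfWeightAtMostₛ σ S w`. -/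
theorem claimsₛ_of {σ : SMSchedule} {S : SMCode ℓ m} (hσ : σ.CycleFacts S) (w N₁ : ℕ)
    (hlow : ¬ HasLogicalFaultOfWeightAtMostAtₛ σ S (w - 1) (w - 1))
    (hwit : HasLogicalFaultOfWeightAtMostAtₛ σ S N₁ w) :
    ¬ HasLogicalFaultOfWeightAtMostₛ σ S (w - 1) ∧ HasLogicalFaultOfWeightAtMostₛ σ S w :=
  ⟨fun ⟨Nc, h⟩ => not_hasAtₛ_of_not_hasAtₛ_self hσ (w - 1) hlow Nc h, ⟨N₁, hwit⟩⟩

/-- The shape of the claims (cf. `claim_shape_of`): with a one-cycle witness, `∀ Nc ≥ 1, circuitDistanceₛ σ S Nc = w`. -/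
theorem claim_shapeₛ_of {σ : SMSchedule} {S : SMCode ℓ m} (hσ : σ.CycleFacts S) (w : ℕ) (hw : 1 ≤ w)
    (hlow : ¬ HasLogicalFaultOfWeightAtMostAtₛ σ S (w - 1) (w - 1))
    (hwit : HasLogicalFaultOfWeightAtMostAtₛ σ S 1 w) : ∀ Nc : ℕ, 1 ≤ Nc → circuitDistanceₛ σ S Nc = w :=
  fun Nc hNc => circuitDistanceₛ_eq_of hσ w 1 hw hlow hwit Nc hNc

/-! ## The #345 assembly shape -/

/-- **ASSEMBLY SHAPE for order #345** (what the Q4 kernel lane has to discharge, director-qec R156 (2)): the two SECTOR EXCLUSIONS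
at `N₀ = 10` cycles and weight `10` — `X`: no undetectable set of `≤ 10` operations with a residual outside the `X`-stabilisers
(from `o345XTable`, the 246 `X`-sector leaves and the W = 10 list-completeness tower via `no_xLogical_of_leavesCₛ`); `Z`: its
mirror (from the transport lemma) — decide the pre-registered question NEGATIVELY: `¬ CDX_Q4_345`. -/
theorem not_CDX_Q4_345_of_sectors
    (hX : ¬ ∃ F : Finset (Fault 12 6), Gen.Undetectable bb144SM 10 (allEventsₛ sched345 10) F ∧
      Gen.dataX bb144SM (allEventsₛ sched345 10) F ∉ rowSpace bb144SM.toCode.HX ∧ faultCount F ≤ 10)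
    (hZ : ¬ ∃ F : Finset (Fault 12 6), Gen.Undetectable bb144SM 10 (allEventsₛ sched345 10) F ∧
      Gen.dataZ bb144SM (allEventsₛ sched345 10) F ∉ rowSpace bb144SM.toCode.HZ ∧ faultCount F ≤ 10) :
    ¬ CDX_Q4_345 :=
  not_CDX_Q4_345_of_not_at (not_hasAtₛ_of_sectors sched345 bb144SM 10 10 hX hZ)

/-- … and hence, with the landed weight-11 witness (`WitnessesQ4`/`SchedMono`), the VALUE: `∀ Nc ≥ 1, circuitDistanceₛ sched345
bb144SM Nc = 11` (the composition of record for the Q4 word; its two hypotheses are the sector exclusions above). -/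
theorem sched345_circuitDistance_eq_eleven_of_sectors
    (hX : ¬ ∃ F : Finset (Fault 12 6), Gen.Undetectable bb144SM 10 (allEventsₛ sched345 10) F ∧
      Gen.dataX bb144SM (allEventsₛ sched345 10) F ∉ rowSpace bb144SM.toCode.HX ∧ faultCount F ≤ 10)
    (hZ : ¬ ∃ F : Finset (Fault 12 6), Gen.Undetectable bb144SM 10 (allEventsₛ sched345 10) F ∧
      Gen.dataZ bb144SM (allEventsₛ sched345 10) F ∉ rowSpace bb144SM.toCode.HZ ∧ faultCount F ≤ 10) :
    ∀ Nc : ℕ, 1 ≤ Nc → circuitDistanceₛ sched345 bb144SM Nc = 11 :=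
  claim_shapeₛ_of (sched345_cycleFacts bb144SM) 11 (by norm_num) (not_hasAtₛ_of_sectors sched345 bb144SM 10 10 hX hZ)
    sched345_hasLogicalFault_eleven_Z

end Summit.Ventures.QEC.CircuitDistance
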